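import Literature.Probability.Percolation.TrackExchangeTop
import HarnessLib

/-!
# Vertical crossings through a track exchange: the record height after one sweep

Grimmett–Manolescu, *Bond percolation on isoradial graphs* (PTRF 159 (2014) 273–327 =
arXiv:1204.0505), §6.3, proof of Lemma 6.9. The quantity followed through the track exchanges
is the greatest height reached, inside a trapezium `D`, by an open path started at height `0`:
"`h^k_j = sup{h ≤ N : ∃ x₁, x₂ ∈ ℤ with v_{x₁,0} ↔ v_{x₂,h} in D^k_j, ω^k_j}`", and the three facts
(6.32)–(6.34) about its change `h^k_j → h^k_{j+1}` under one exchange `Σ_{j+1}`: it decreases by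
at most `1`; it does not decrease unless it equals the height of the middle row of the exchange;
and if it does equal it, it still does not decrease on a favourable event. "Let `γ` be an
`ω^k_j`-open path of `Ψ_j(G^k)`, lying in `D^k_j`, with one endpoint at height `0` and the other at
height `h^k_j` […] all other vertices with heights between `1` and `h(γ) - 1`."

This file defines the record height on the strip of `TrackExchangeStrip` and proves the
*deterministic* part of (6.32)–(6.34) for one sweep from left to right (`ExchangeData.sweep`),
on top of the edge-level analysis of `TrackExchangeTop`:

* `TrackExchange.Dom c ℓ` — the trapezium before the sweep of level `ℓ`:
  `{(m, y) : 0 ≤ y, |m| ≤ c + y + 2·[y < ℓ]}` (GM14 (6.30), with the widening by `2` granted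
  to a row when it becomes the middle row; `Dom_mono`, `Dom_subset_Dom_add_two`);
* `TrackExchange.Reaches S ω y` (an `ω`-open walk of labels inside `S` from height `0` to
  height `y`), `TrackExchange.hRec S N ω` (**the record height**, the greatest such `y ≤ N`) and
  its characterisation (`reaches_hRec`, `le_hRec`);
* `TrackExchange.cutAt`, `TrackExchange.TopWit` — GM14's paths `𝒫_j`: a witness can be cut at
  its first visit to its top height, so that the top is visited only at the end
  (`exists_topWit`);
* the record height after the sweep of level `ℓ = j` of `D : ExchangeData` (clean
  configuration, wide strip), for the domain `Dom c (ℓ+1)`: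
  - `reaches_sweep_of_lt`, `reaches_sweep_of_gt` — a record `≠ ℓ` is kept (GM14 (6.33));
  - `reaches_sweep_sub_one` — a record `= ℓ` drops by at most one (GM14 (6.32));
  - `reaches_sweep_keptTop` — a record `= ℓ` reached from the left is kept (Fig. 6.5);
  - `reaches_sweep_goodTop` — a record `= ℓ` reached from the right is kept when `e₃` is
    closed and the designated uniform variable lies in `goodU` (Fig. 6.6, the event of (6.37));
  - `hRec_sweep_ge_of_ne`, `hRec_sweep_add_one_ge` — the same in terms of `hRec`.

The probability of the favourable event and the assembly over the `N²` sweeps are in the sequel.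

## References

* G. R. Grimmett, I. Manolescu, PTRF 159 (2014) 273–327, arXiv:1204.0505, §6.3: (6.30)–(6.34),
  the paths `𝒫_j`, Figures 6.5–6.6.
-/

noncomputable section

namespace Literature.Probability.Percolation

open LatticeModels StarTriangle Real MeasureTheory

namespace TrackExchange

/-! ### Domains -/

/-- **The trapezium before the sweep of level `ℓ`**: heights `≥ 0`, `|m| ≤ c + y + 2·[y < ℓ]`
(GM14 (6.30): `|x| ≤ N + 2k + y (+1, +2)`; here a row is widened by `2` at once when it becomes
the middle row of an exchange). [cite: GrimmettManolescu2014Isoradial, §6.3 (6.30)] -/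
def Dom (c ℓ : ℤ) : Set (ℤ × ℤ) := {z | 0 ≤ z.2 ∧ |z.1| ≤ c + z.2 + (if z.2 < ℓ then 2 else 0)}

/-- Membership in the trapezium. [folklore] -/
theorem mem_Dom_iff {c ℓ : ℤ} {z : ℤ × ℤ} : z ∈ Dom c ℓ ↔ 0 ≤ z.2 ∧ |z.1| ≤ c + z.2 + (if z.2 < ℓ then 2 else 0) :=
  Iff.rfl

/-- The trapezia increase with the level. [cite: GrimmettManolescu2014Isoradial, §6.3] -/
theorem Dom_mono {c ℓ ℓ' : ℤ} (h : ℓ ≤ ℓ') : Dom c ℓ ⊆ Dom c ℓ' := by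
  rintro ⟨m, y⟩ ⟨hy, hm⟩
  refine ⟨hy, hm.trans ?_⟩
  simp only
  split_ifs <;> omega

/-- The trapezium of any level is contained in every trapezium of constant `c + 2` (GM14:
`D^k_{2N-k} ⊆ D^{k+1}`). [cite: GrimmettManolescu2014Isoradial, §6.3] -/
theorem Dom_subset_Dom_add_two {c ℓ ℓ' : ℤ} : Dom c ℓ ⊆ Dom (c + 2) ℓ' := by
  rintro ⟨m, y⟩ ⟨hy, hm⟩
  refine ⟨hy, hm.trans ?_⟩
  simp only
  split_ifs <;> omega

/-- The trapezia are symmetric under the reflection of the strip. [folklore] -/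
theorem neg_mem_Dom_iff {c ℓ m y : ℤ} : (-m, y) ∈ Dom c ℓ ↔ (m, y) ∈ Dom c ℓ := by
  simp only [mem_Dom_iff, abs_neg]

/-- Columns in the trapezium are bounded. [folklore] -/
theorem abs_le_of_mem_Dom {c ℓ m y : ℤ} (h : (m, y) ∈ Dom c ℓ) : |m| ≤ c + y + 2 := by
  have := h.2
  simp only at this
  split_ifs at this <;> omega

/-! ### Walks of labels inside a domain, reachable heights, the record height -/

/-- The height of a label (`⋆ ↦ 0`, never used). [folklore] -/
def lht : SV → ℤ
  | some a => a.2
  | none => 0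

/-- All vertices of the walk are labels in `S`. [folklore] -/
def InDom (S : Set (ℤ × ℤ)) (W : List SV) : Prop := ∀ z ∈ W, ∃ a : ℤ × ℤ, z = some a ∧ a ∈ S

/-- **Height `y` is reached in `ω` within `S`**: an `ω`-open walk of labels in `S` from a vertex
of height `0` to a vertex of height `y` (GM14: "`v_{x₁,0} ↔ v_{x₂,h}` in `D, ω`"). [cite: GrimmettManolescu2014Isoradial, §6.3] -/
def Reaches (S : Set (ℤ × ℤ)) (ω : Set (Sym2 SV)) (y : ℤ) : Prop :=
  ∃ W : List SV, IsWalk ω W ∧ InDom S W ∧ (∃ a : ℤ × ℤ, W.head? = some (some a) ∧ a.2 = 0) ∧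
    ∃ b : ℤ × ℤ, W.getLast? = some (some b) ∧ b.2 = y

/-- **The record height** `h = sup{y ≤ N : height y is reached within S}` (GM14's `h^k_j`).
[cite: GrimmettManolescu2014Isoradial, §6.3] -/
def hRec (S : Set (ℤ × ℤ)) (N : ℕ) (ω : Set (Sym2 SV)) : ℕ := sSup {n : ℕ | n ≤ N ∧ Reaches S ω n}

/-- A vertex of height `0` in `S` reaches height `0`. [folklore] -/
theorem reaches_zero {S : Set (ℤ × ℤ)} {ω : Set (Sym2 SV)} {m : ℤ} (h : (m, (0 : ℤ)) ∈ S) : Reaches S ω 0 :=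
  ⟨[some (m, 0)], trivial, fun z hz => ⟨(m, 0), by simpa using hz, h⟩, ⟨(m, 0), rfl, rfl⟩, ⟨(m, 0), rfl, rfl⟩⟩

/-- The record height is at most `N`. [folklore] -/
theorem hRec_le {S : Set (ℤ × ℤ)} {N : ℕ} {ω : Set (Sym2 SV)} (h0 : Reaches S ω 0) : hRec S N ω ≤ N := by
  have hne : {n : ℕ | n ≤ N ∧ Reaches S ω n}.Nonempty := ⟨0, Nat.zero_le _, by exact_mod_cast h0⟩
  have hbdd : BddAbove {n : ℕ | n ≤ N ∧ Reaches S ω n} := ⟨N, fun n hn => hn.1⟩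
  exact (Nat.sSup_mem hne hbdd).1

/-- **The record height is reached.** [cite: GrimmettManolescu2014Isoradial, §6.3] -/
theorem reaches_hRec {S : Set (ℤ × ℤ)} {N : ℕ} {ω : Set (Sym2 SV)} (h0 : Reaches S ω 0) :
    Reaches S ω (hRec S N ω) := by
  have hne : {n : ℕ | n ≤ N ∧ Reaches S ω n}.Nonempty := ⟨0, Nat.zero_le _, by exact_mod_cast h0⟩
  have hbdd : BddAbove {n : ℕ | n ≤ N ∧ Reaches S ω n} := ⟨N, fun n hn => hn.1⟩
  exact (Nat.sSup_mem hne hbdd).2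

/-- **Every height `≤ N` reached is at most the record.** [cite: GrimmettManolescu2014Isoradial, §6.3] -/
theorem le_hRec {S : Set (ℤ × ℤ)} {N : ℕ} {ω : Set (Sym2 SV)} {n : ℕ} (hn : n ≤ N) (h : Reaches S ω n) :
    n ≤ hRec S N ω :=
  le_csSup ⟨N, fun _ hm => hm.1⟩ ⟨hn, h⟩

/-- The record is monotone in the domain. [folklore] -/
theorem reaches_mono {S S' : Set (ℤ × ℤ)} (hS : S ⊆ S') {ω : Set (Sym2 SV)} {y : ℤ} (h : Reaches S ω y) :
    Reaches S' ω y := by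
  obtain ⟨W, hW, hD, hh, hl⟩ := h
  exact ⟨W, hW, fun z hz => by obtain ⟨a, rfl, ha⟩ := hD z hz; exact ⟨a, rfl, hS ha⟩, hh, hl⟩

/-! ### Cutting a witness at its first visit to the top (GM14's paths `𝒫_j`) -/

/-- The prefix of a walk up to and including its first vertex of height `y`. [folklore] -/
def cutAt (y : ℤ) : List SV → List SV
  | [] => []
  | z :: rest => if lht z = y then [z] else z :: cutAt y rest

/-- `cutAt` of a nonempty list is nonempty. [folklore] -/
theorem cutAt_ne_nil (y : ℤ) {W : List SV} (h : W ≠ []) : cutAt y W ≠ [] := by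
  cases W with
  | nil => exact absurd rfl h
  | cons z rest => simp only [cutAt]; split_ifs <;> simp

/-- `cutAt` keeps the first vertex. [folklore] -/
theorem head?_cutAt (y : ℤ) (W : List SV) : (cutAt y W).head? = W.head? := by
  cases W with
  | nil => rfl
  | cons z rest => simp only [cutAt]; split_ifs <;> rfl

/-- Every vertex of `cutAt y W` is a vertex of `W`. [folklore] -/
theorem mem_of_mem_cutAt (y : ℤ) : ∀ {W : List SV} {z : SV}, z ∈ cutAt y W → z ∈ W
  | [], _, h => h
  | z :: rest, w, h => by
    simp only [cutAt] at h
    split_ifs at h with hz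
    · simp only [List.mem_singleton] at h; simp [h]
    · rcases List.mem_cons.1 h with rfl | h
      · exact List.mem_cons_self
      · exact List.mem_cons_of_mem _ (mem_of_mem_cutAt y h)

/-- `cutAt` of a walk is a walk. [folklore] -/
theorem isWalk_cutAt {ω : Set (Sym2 SV)} (y : ℤ) : ∀ {W : List SV}, IsWalk ω W → IsWalk ω (cutAt y W)
  | [], _ => trivial
  | [z], _ => by simp only [cutAt]; split_ifs <;> trivial
  | a :: b :: l, h => by
    simp only [cutAt]
    split_ifs with ha hb
    · trivial
    · exact ⟨h.1, trivial⟩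
    · have ih := isWalk_cutAt y h.2
      simp only [cutAt, if_neg hb] at ih
      exact ⟨h.1, ih⟩

/-- If some vertex of `W` has height `y`, the last vertex of `cutAt y W` has height `y`. [folklore] -/
theorem getLast?_cutAt (y : ℤ) : ∀ {W : List SV}, (∃ z ∈ W, lht z = y) →
    ∃ z, (cutAt y W).getLast? = some z ∧ lht z = y
  | [], ⟨z, hz, _⟩ => absurd hz List.not_mem_nil
  | z :: rest, ⟨w, hw, hwy⟩ => by
    simp only [cutAt]
    split_ifs with hz
    · exact ⟨z, rfl, hz⟩
    · have hrest : ∃ z ∈ rest, lht z = y := by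
        rcases List.mem_cons.1 hw with rfl | hw
        · exact absurd hwy hz
        · exact ⟨w, hw, hwy⟩
      obtain ⟨z', hz', hy⟩ := getLast?_cutAt y hrest
      have hne : cutAt y rest ≠ [] := by intro h; rw [h] at hz'; simp at hz'
      exact ⟨z', by rw [getLast?_cons_of_ne_nil hne, hz'], hy⟩

/-- No vertex of `cutAt y W` before the last has height `y`. [folklore] -/
theorem lht_ne_of_mem_dropLast_cutAt (y : ℤ) : ∀ {W : List SV} {z : SV}, z ∈ (cutAt y W).dropLast → lht z ≠ y
  | [], _, h => by simp [cutAt] at h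
  | w :: rest, z, h => by
    simp only [cutAt] at h
    split_ifs at h with hw
    · simp at h
    · have hne : ∀ (l : List SV), l ≠ [] → (w :: l).dropLast = w :: l.dropLast := fun l hl => by
        cases l with
        | nil => exact absurd rfl hl
        | cons _ _ => rfl
      by_cases hrest : rest = []
      · subst hrest; simp [cutAt] at h
      · rw [hne _ (cutAt_ne_nil y hrest)] at h
        rcases List.mem_cons.1 h with rfl | h
        · exact hw
        · exact lht_ne_of_mem_dropLast_cutAt y h

/-- **A walk whose heights move by at most one per step, started at height `≤ y` and never at
height `y`, stays strictly below `y`** (discrete intermediate values). [folklore] -/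
theorem lht_lt_of_forall_ne {y : ℤ} : ∀ {W : List SV}, (∀ a b, [a, b] <:+: W → lht b ≤ lht a + 1) →
    (∀ z, W.head? = some z → lht z ≤ y) → (∀ z ∈ W, lht z ≠ y) → ∀ z ∈ W, lht z < y
  | [], _, _, _, z, hz => absurd hz List.not_mem_nil
  | [a], _, hh, hne, z, hz => by
    simp only [List.mem_singleton] at hz; subst hz
    exact lt_of_le_of_ne (hh z rfl) (hne z (by simp))
  | a :: b :: l, hstep, hh, hne, z, hz => by
    have ha : lht a < y := lt_of_le_of_ne (hh a rfl) (hne a (by simp))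
    rcases List.mem_cons.1 hz with rfl | hz
    · exact ha
    · refine lht_lt_of_forall_ne (W := b :: l) (fun c d hcd => hstep c d (List.infix_cons hcd)) ?_
        (fun w hw => hne w (List.mem_cons_of_mem _ hw)) z hz
      intro w hw
      simp only [List.head?_cons, Option.some.injEq] at hw
      rw [← hw]
      have := hstep a b (pair_infix_cons_cons a b l)
      omega

/-- **A top witness** (GM14's `γ ∈ 𝒫_j`): an open walk of labels in `S` from height `0` whose
last vertex `b` has height `y` and all of whose other vertices are strictly lower.
[cite: GrimmettManolescu2014Isoradial, §6.3] -/
structure TopWit (S : Set (ℤ × ℤ)) (ω : Set (Sym2 SV)) (y : ℤ) (W : List SV) : Prop where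
  /-- open -/
  walk : IsWalk ω W
  /-- inside the domain -/
  dom : InDom S W
  /-- from height `0` -/
  head : ∃ a : ℤ × ℤ, W.head? = some (some a) ∧ a.2 = 0
  /-- to height `y` -/
  last : ∃ b : ℤ × ℤ, W.getLast? = some (some b) ∧ b.2 = y
  /-- all other vertices are lower -/
  below : ∀ z ∈ W.dropLast, lht z < y

/-- A top witness reaches its height. [folklore] -/
theorem TopWit.reaches {S : Set (ℤ × ℤ)} {ω : Set (Sym2 SV)} {y : ℤ} {W : List SV} (h : TopWit S ω y W) :
    Reaches S ω y :=
  ⟨W, h.walk, h.dom, h.head, h.last⟩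

/-- Heights along an open walk of a clean configuration move by one per step. [folklore] -/
theorem lht_step_of_clean {M : ℕ} {Θ : ℤ → ℤ → ℝ} {ω : Set (Sym2 SV)} (hc : Clean (canonicalWeight M Θ) ω)
    {a b : ℤ × ℤ} (h : s((some a : SV), some b) ∈ ω) :
    (b.1 = a.1 + 1 ∨ b.1 = a.1 - 1) ∧ (b.2 = a.2 + 1 ∨ b.2 = a.2 - 1) := by
  by_contra hne
  refine hc.not_mem (ExchangeData.canonicalWeight_eq_zero_of_ne M Θ ?_ ?_ ?_ ?_) h <;>
    (rintro rfl; simp at hne)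

/-- In a clean configuration `⋆` is isolated from the labels. [folklore] -/
theorem some_none_notMem_of_clean {M : ℕ} {Θ : ℤ → ℤ → ℝ} {ω : Set (Sym2 SV)} (hc : Clean (canonicalWeight M Θ) ω)
    (a : ℤ × ℤ) : s((some a : SV), none) ∉ ω :=
  hc.not_mem (ExchangeData.canonicalWeight_eq_zero_of_mem_none M Θ (Sym2.mem_mk_right _ _))

/-- An open walk of a clean configuration starting at a label consists of labels. [folklore] -/
theorem forall_ne_none_of_clean {M : ℕ} {Θ : ℤ → ℤ → ℝ} {ω : Set (Sym2 SV)} (hc : Clean (canonicalWeight M Θ) ω) :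
    ∀ {W : List SV}, IsWalk ω W → (∀ z, W.head? = some z → z ≠ none) → ∀ z ∈ W, z ≠ none
  | [], _, _, z, hz => absurd hz List.not_mem_nil
  | [a], _, hh, z, hz => by simp only [List.mem_singleton] at hz; subst hz; exact hh z rfl
  | a :: b :: l, hW, hh, z, hz => by
    have ha : a ≠ none := hh a rfl
    rcases List.mem_cons.1 hz with rfl | hz
    · exact ha
    · refine forall_ne_none_of_clean hc hW.2 (fun w hw => ?_) z hz
      simp only [List.head?_cons, Option.some.injEq] at hw; subst hw
      obtain ⟨a', rfl⟩ := Option.ne_none_iff_exists'.1 ha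
      rintro rfl
      exact some_none_notMem_of_clean hc a' hW.1

/-- **Cutting a witness at its first visit to the top** (GM14: the sub-path in `𝒫_j` of an
optimal path): in a clean configuration, if height `y ≥ 0` is reached within `S` then it is
reached by a top witness. [cite: GrimmettManolescu2014Isoradial, §6.3] -/
theorem exists_topWit {M : ℕ} {Θ : ℤ → ℤ → ℝ} {ω : Set (Sym2 SV)} (hc : Clean (canonicalWeight M Θ) ω)
    {S : Set (ℤ × ℤ)} {y : ℤ} (hy : 0 ≤ y) (h : Reaches S ω y) : ∃ W, TopWit S ω y W := by
  obtain ⟨W, hW, hD, ⟨a, ha, ha0⟩, ⟨b, hb, hby⟩⟩ := h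
  have hWne : W ≠ [] := by rintro rfl; simp at ha
  refine ⟨cutAt y W, isWalk_cutAt y hW, fun z hz => hD z (mem_of_mem_cutAt y hz), ⟨a, by rw [head?_cutAt, ha], ha0⟩, ?_, ?_⟩
  · have hmem : ∃ z ∈ W, lht z = y := ⟨some b, List.mem_of_getLast? hb, hby⟩
    obtain ⟨z, hz, hzy⟩ := getLast?_cutAt y hmem
    obtain ⟨b', rfl, -⟩ := hD z (mem_of_mem_cutAt y (List.mem_of_getLast? hz))
    exact ⟨b', hz, hzy⟩
  · -- below the top before the last vertex: heights move by one and never equal `y` there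
    have hcut := isWalk_cutAt y hW
    set V := cutAt y W with hV
    have hVD : InDom S V := fun z hz => hD z (mem_of_mem_cutAt y hz)
    -- the walk `V.dropLast` is a prefix of `V`
    have hpre : V.dropLast <+: V := List.dropLast_prefix V
    have hwalk' : IsWalk ω V.dropLast := by
      rw [isWalk_iff_isChain] at hcut ⊢
      exact hcut.infix hpre.isInfix
    refine lht_lt_of_forall_ne (W := V.dropLast) (fun c d hcd => ?_) (fun z hz => ?_)
      (fun z hz => lht_ne_of_mem_dropLast_cutAt y hz)
    · have hcd' : s(c, d) ∈ ω := hwalk'.mem_of_infix hcd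
      obtain ⟨c', rfl, -⟩ := hVD c (hpre.subset (hcd.subset (by simp)))
      obtain ⟨d', rfl, -⟩ := hVD d (hpre.subset (hcd.subset (by simp)))
      have := (lht_step_of_clean hc hcd').2
      simp only [lht]; omega
    · -- the first vertex of the prefix is the first vertex `a`, at height `0 ≤ y`
      have hV0 : V.head? = some (some a) := by rw [hV, head?_cutAt, ha]
      cases hVl : V.dropLast with
      | nil => rw [hVl] at hz; simp at hz
      | cons w l =>
        rw [hVl] at hz hpre
        simp only [List.head?_cons, Option.some.injEq] at hz; subst hz
        obtain ⟨t, ht⟩ := hpre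
        rw [← ht] at hV0
        simp only [List.cons_append, List.head?_cons, Option.some.injEq] at hV0
        subst hV0
        simp only [lht]; omega

/-- **Vertices with an open edge are primal** (`m + y` even) in a clean configuration. [folklore] -/
theorem even_of_mem_clean {M : ℕ} {Θ : ℤ → ℤ → ℝ} {ω : Set (Sym2 SV)} (hc : Clean (canonicalWeight M Θ) ω)
    {a b : ℤ × ℤ} (h : s((some a : SV), some b) ∈ ω) : Even (a.1 + a.2) := by
  have hpos := hc _ h
  rw [canonicalWeight_mk] at hpos
  by_contra hodd
  have h1 : dirWeight M Θ (some a) (some b) = 0 := by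
    simp only [dirWeight]
    rw [if_neg (fun h' => hodd h'.2.1), if_neg]
    rintro ⟨-, h', -⟩
    exact hodd (by obtain ⟨r, hr⟩ := Int.not_even_iff_odd.1 h'; exact ⟨r + 1, by omega⟩)
  have h2 : dirWeight M Θ (some b) (some a) = 0 := by
    simp only [dirWeight]
    rw [if_neg, if_neg]
    · rintro ⟨h', h'', -⟩
      obtain ⟨r, hr⟩ := Int.not_even_iff_odd.1 h''
      exact hodd ⟨r + 1, by rw [h']; simp only; omega⟩
    · rintro ⟨h', h'', -⟩
      obtain ⟨r, hr⟩ := h''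
      exact hodd ⟨r + 1, by rw [h']; simp only; omega⟩
  rw [h1, h2, max_self] at hpos
  exact lt_irrefl _ hpos

/-- The last two vertices of a list form an infix. [folklore] -/
theorem pair_infix_of_getLast? {W : List SV} {a b : SV} (h1 : W.dropLast.getLast? = some a)
    (h2 : W.getLast? = some b) : [a, b] <:+: W := by
  obtain ⟨ys, rfl⟩ := List.getLast?_eq_some_iff.1 h2
  rw [List.dropLast_concat] at h1
  obtain ⟨zs, rfl⟩ := List.getLast?_eq_some_iff.1 h1
  exact ⟨zs, [], by simp⟩

/-- The first vertex of an infix pair is not the last vertex. [folklore] -/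
theorem mem_dropLast_of_pair_infix {W : List SV} {p q : SV} (h : [p, q] <:+: W) : p ∈ W.dropLast := by
  obtain ⟨s, t, rfl⟩ := h
  rw [List.append_assoc, List.dropLast_append_of_ne_nil (by simp)]
  simp only [List.cons_append, List.mem_append]
  right
  rw [List.dropLast_cons_of_ne_nil (by simp)]
  exact List.mem_cons_self

/-- In a top witness, an infix pair ending at the top height is the pair of the last two
vertices. [folklore] -/
theorem TopWit.eq_last_of_infix {S : Set (ℤ × ℤ)} {ω : Set (Sym2 SV)} {y : ℤ} {W : List SV} (h : TopWit S ω y W)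
    {p q : SV} (hpq : [p, q] <:+: W) (hq : lht q = y) : W.dropLast.getLast? = some p ∧ W.getLast? = some q := by
  obtain ⟨s, t, hst⟩ := hpq
  cases t with
  | nil =>
    subst hst
    simp
  | cons c t =>
    exfalso
    have hq' : q ∈ W.dropLast := by
      rw [← hst]
      have : s ++ [p, q] ++ c :: t = (s ++ [p, q] ++ (c :: t).dropLast) ++ [(c :: t).getLast (by simp)] := by
        rw [List.append_assoc (s ++ [p, q]), List.dropLast_append_getLast]
      rw [this, List.dropLast_concat]
      simp
    exact absurd hq (ne_of_lt (h.below q hq'))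

/-- The vertex before the top of a top witness at a positive height. [folklore] -/
theorem TopWit.exists_dropLast_getLast {M : ℕ} {Θ : ℤ → ℤ → ℝ} {ω : Set (Sym2 SV)}
    (hc : Clean (canonicalWeight M Θ) ω) {S : Set (ℤ × ℤ)} {y : ℤ} {W : List SV} (hW : TopWit S ω y W)
    (hy : y ≠ 0) : ∃ a b : ℤ × ℤ, W.dropLast.getLast? = some (some a) ∧ W.getLast? = some (some b) ∧
      b.2 = y ∧ a.2 = y - 1 ∧ (a.1 = b.1 + 1 ∨ a.1 = b.1 - 1) := by
  obtain ⟨b, hb, hby⟩ := hW.last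
  obtain ⟨a₀, ha₀, ha₀0⟩ := hW.head
  -- the witness has at least two vertices
  obtain ⟨ys, rfl⟩ := List.getLast?_eq_some_iff.1 hb
  have hys : ys ≠ [] := by
    rintro rfl
    simp only [List.nil_append, List.head?_cons, Option.some.injEq] at ha₀
    cases ha₀; omega
  obtain ⟨zs, p, hzp⟩ := List.eq_nil_or_concat ys |>.resolve_left hys
  rw [List.concat_eq_append] at hzp
  subst hzp
  have hp : p ∈ (zs ++ [p] ++ [some b]).dropLast := by rw [List.dropLast_concat]; simp
  obtain ⟨a, rfl, -⟩ := hW.dom p ((List.dropLast_subset _) hp)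
  have hedge : s((some a : SV), some b) ∈ ω :=
    hW.walk.mem_of_infix ⟨zs, [], by simp⟩
  have hstep := lht_step_of_clean hc hedge
  have hlt := hW.below _ hp
  simp only [lht] at hlt
  refine ⟨a, b, by rw [List.dropLast_concat]; simp, by simp, hby, by omega, by omega⟩

/-- Appending one vertex joined to the last one. [folklore] -/
theorem isWalk_append_singleton {ω : Set (Sym2 SV)} {V : List SV} {p q : SV} (hV : IsWalk ω V)
    (hlast : V.getLast? = some p) (he : s(p, q) ∈ ω) : IsWalk ω (V ++ [q]) := by
  rw [isWalk_iff_isChain] at hV ⊢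
  refine hV.append (List.isChain_singleton q) fun a ha b hb => ?_
  rw [Option.mem_def] at ha hb
  rw [hlast, Option.some.injEq] at ha
  simp only [List.head?_cons, Option.some.injEq] at hb
  subst ha; subst hb
  exact he

/-! ### One sweep from left to right: the record height afterwards -/

namespace ExchangeData

variable {D : ExchangeData}

/-- **The sweep keeps configurations clean** (for the exchanged weights). [cite: GrimmettManolescu2014Isoradial, §5.3] -/
theorem clean_sweep (hV : D.Valid) {ω : Set (Sym2 SV)} (hc : Clean D.initial ω)
    (r : unitInterval × (Fin (2 * D.M) → unitInterval)) : Clean D.exchanged (D.sweep ω r) := by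
  have := (slide_invariant hV (fun _ _ => True) (Clean.insertStep hV hc r.1) trivial r.2 fun _ _ _ _ => trivial).1
  exact Clean.removeStep this

/-- **A walk off the middle row is untouched by the sweep** (frame of the sweep).
[cite: GrimmettManolescu2014Isoradial, §6.3 (6.33)] -/
theorem isWalk_sweep_of_forall_ne {ω : Set (Sym2 SV)} (hc : Clean D.initial ω) {W : List SV}
    (hW : IsWalk ω W) (hlab : ∀ z ∈ W, ∃ a : ℤ × ℤ, z = some a ∧ a.2 ≠ D.j)
    (r : unitInterval × (Fin (2 * D.M) → unitInterval)) : IsWalk (D.sweep ω r) W := by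
  refine hW.of_forall_mem fun p q hpq hmem => ?_
  obtain ⟨a, rfl, ha⟩ := hlab p (hpq.subset (by simp))
  obtain ⟨b, rfl, hb⟩ := hlab q (hpq.subset (by simp))
  have hab := (lht_step_of_clean hc hmem).1
  exact (mem_sweep_iff_of_offMid ha hb (by omega) ω r).2 hmem

/-- **A record below the middle row is kept** (GM14 (6.33), first case). [cite: GrimmettManolescu2014Isoradial, §6.3 (6.33)] -/
theorem reaches_sweep_of_lt {ω : Set (Sym2 SV)} (hc : Clean D.initial ω) {c y : ℤ} {W : List SV}
    (hW : TopWit (Dom c D.j) ω y W) (hy : y < D.j) (r : unitInterval × (Fin (2 * D.M) → unitInterval)) :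
    Reaches (Dom c (D.j + 1)) (D.sweep ω r) y := by
  have hlab : ∀ z ∈ W, ∃ a : ℤ × ℤ, z = some a ∧ a.2 ≠ D.j := by
    intro z hz
    obtain ⟨a, rfl, -⟩ := hW.dom z hz
    refine ⟨a, rfl, ?_⟩
    -- every vertex has height `≤ y < j`
    by_cases hlast : some a ∈ W.dropLast
    · have := hW.below _ hlast; simp only [lht] at this; omega
    · obtain ⟨b, hb, hby⟩ := hW.last
      have hWd : W = W.dropLast ++ [some b] := by
        rw [List.getLast?_eq_some_iff] at hb
        obtain ⟨ys, rfl⟩ := hb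
        rw [List.dropLast_concat]
      rw [hWd, List.mem_append, List.mem_singleton] at hz
      rcases hz with hz | hz
      · exact absurd hz hlast
      · cases hz; omega
  exact reaches_mono (Dom_mono (by omega))
    ⟨W, isWalk_sweep_of_forall_ne hc hW.walk hlab r, hW.dom, hW.head, hW.last⟩

/-- **A record at the middle row drops by at most one** (GM14 (6.32)): the witness without its
last vertex is untouched. [cite: GrimmettManolescu2014Isoradial, §6.3 (6.32)] -/
theorem reaches_sweep_sub_one {ω : Set (Sym2 SV)} (hc : Clean D.initial ω) {c : ℤ} {W : List SV}
    (hW : TopWit (Dom c D.j) ω D.j W) (hj : 1 ≤ D.j) (r : unitInterval × (Fin (2 * D.M) → unitInterval)) :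
    Reaches (Dom c (D.j + 1)) (D.sweep ω r) (D.j - 1) := by
  obtain ⟨a, b, ha, hb, -, hay, -⟩ := hW.exists_dropLast_getLast hc (by omega)
  have hpre : W.dropLast <+: W := List.dropLast_prefix W
  have hwalk : IsWalk ω W.dropLast := by
    have := hW.walk
    rw [isWalk_iff_isChain] at this ⊢
    exact this.infix hpre.isInfix
  have hlab : ∀ z ∈ W.dropLast, ∃ a : ℤ × ℤ, z = some a ∧ a.2 ≠ D.j := fun z hz => by
    obtain ⟨a', rfl, -⟩ := hW.dom z (hpre.subset hz)
    have := hW.below _ hz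
    simp only [lht] at this
    exact ⟨a', rfl, by omega⟩
  obtain ⟨a₀, ha₀, ha₀0⟩ := hW.head
  have hne : W.dropLast ≠ [] := by intro h; rw [h] at ha; simp at ha
  refine reaches_mono (Dom_mono (by omega)) ⟨W.dropLast, isWalk_sweep_of_forall_ne hc hwalk hlab r,
    fun z hz => hW.dom z (hpre.subset hz), ⟨a₀, ?_, ha₀0⟩, ⟨a, ha, hay⟩⟩
  obtain ⟨t, ht⟩ := hpre
  rw [← ht, List.head?_append_of_ne_nil _ hne] at ha₀
  exact ha₀

/-- **A record at the middle row reached from the left is kept** (GM14 Fig. 6.5): the whole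
witness is open after the sweep. [cite: GrimmettManolescu2014Isoradial, §6.3 (6.33), Fig. 6.5] -/
theorem reaches_sweep_keptTop (hV : D.Valid) {ω : Set (Sym2 SV)} (hc : Clean D.initial ω) {c : ℤ} {N : ℕ}
    (hwide : c + N + 4 ≤ D.M) (hjN : D.j ≤ N) {W : List SV} (hW : TopWit (Dom c D.j) ω D.j W) {x : ℤ}
    (ha : W.dropLast.getLast? = some (some (x - 1, D.j - 1))) (hb : W.getLast? = some (some (x, D.j)))
    (r : unitInterval × (Fin (2 * D.M) → unitInterval)) : Reaches (Dom c (D.j + 1)) (D.sweep ω r) D.j := by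
  have hx : |x| ≤ c + D.j := by
    obtain ⟨b, hb', hbD⟩ := hW.dom _ (List.mem_of_getLast? hb)
    cases hb'
    have := hbD.2
    simp only [lt_self_iff_false, if_false, add_zero] at this
    exact this
  refine reaches_mono (Dom_mono (by omega)) ⟨W, ?_, hW.dom, hW.head, ⟨(x, D.j), hb, rfl⟩⟩
  refine hW.walk.of_forall_mem fun p q hpq hmem => ?_
  obtain ⟨a, rfl, -⟩ := hW.dom p (hpq.subset (by simp))
  obtain ⟨b, rfl, -⟩ := hW.dom q (hpq.subset (by simp))
  by_cases hq : b.2 = D.j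
  · -- the last edge
    obtain ⟨h1, h2⟩ := hW.eq_last_of_infix hpq hq
    rw [ha] at h1; rw [hb] at h2
    cases h1; cases h2
    exact mem_sweep_keptTop hV (by have := abs_le.1 hx; omega) hc hmem r
  · -- an edge below the middle row
    have hp : a.2 < D.j := by
      have := hW.below _ (mem_dropLast_of_pair_infix hpq); simpa [lht] using this
    have hq' : b.2 < D.j := by
      have := (lht_step_of_clean hc hmem).2; omega
    exact (mem_sweep_iff_of_offMid (by omega) (by omega) (by have := (lht_step_of_clean hc hmem).1; omega) ω r).2 hmem

/-- **A record at the middle row reached from the right is kept on the favourable event** (GM14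
Fig. 6.6, the event of (6.37)): `e₃` closed and the designated uniform variable in `goodU`.
[cite: GrimmettManolescu2014Isoradial, §6.3 (6.34), (6.37), Fig. 6.6] -/
theorem reaches_sweep_goodTop (hV : D.Valid) {ω : Set (Sym2 SV)} (hc : Clean D.initial ω) {c : ℤ} {N : ℕ}
    (hwide : c + N + 4 ≤ D.M) (hjN : D.j ≤ N) (hj : 1 ≤ D.j) {W : List SV} (hW : TopWit (Dom c D.j) ω D.j W) {x : ℤ}
    (ha : W.dropLast.getLast? = some (some (x + 1, D.j - 1))) (hb : W.getLast? = some (some (x, D.j)))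
    (h3 : D.leftFaceEdge x ∉ ω) (r : unitInterval × (Fin (2 * D.M) → unitInterval))
    (hu : ∀ t : Fin (2 * D.M), -(D.M : ℤ) + t = x - 1 → r.2 t ∈ D.goodU x) :
    Reaches (Dom c (D.j + 1)) (D.sweep ω r) D.j := by
  have hx : |x| ≤ c + D.j := by
    obtain ⟨b, hb', hbD⟩ := hW.dom _ (List.mem_of_getLast? hb)
    cases hb'
    have := hbD.2
    simp only [lt_self_iff_false, if_false, add_zero] at this
    exact this
  have hx' := abs_le.1 hx
  -- the last edge is open, and the top is primal
  have hedge : s((some (x + 1, D.j - 1) : SV), some (x, D.j)) ∈ ω := hW.walk.mem_of_infix (pair_infix_of_getLast? ha hb)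
  have hpar : Even (x + D.j) := by
    have := even_of_mem_clean hc hedge
    simp only at this
    obtain ⟨r, hr⟩ := this; exact ⟨r, by omega⟩
  have key := goodTop_sweep hV hpar (by omega) (by omega) hc h3 hedge r hu
  -- the witness without its last vertex is untouched and ends at `B_{x+1}`
  have hpre : W.dropLast <+: W := List.dropLast_prefix W
  have hwalk : IsWalk ω W.dropLast := by
    have := hW.walk
    rw [isWalk_iff_isChain] at this ⊢
    exact this.infix hpre.isInfix
  have hlab : ∀ z ∈ W.dropLast, ∃ a : ℤ × ℤ, z = some a ∧ a.2 ≠ D.j := fun z hz => by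
    obtain ⟨a', rfl, -⟩ := hW.dom z (hpre.subset hz)
    have := hW.below _ hz
    simp only [lht] at this
    exact ⟨a', rfl, by omega⟩
  have hV' := isWalk_sweep_of_forall_ne hc hwalk hlab r
  obtain ⟨a₀, ha₀, ha₀0⟩ := hW.head
  have hne : W.dropLast ≠ [] := by intro h; rw [h] at ha; simp at ha
  have hhead : W.dropLast.head? = some (some a₀) := by
    obtain ⟨t, ht⟩ := hpre
    rw [← ht, List.head?_append_of_ne_nil _ hne] at ha₀
    exact ha₀
  have hdomV : InDom (Dom c (D.j + 1)) W.dropLast := fun z hz => by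
    obtain ⟨a', rfl, haD⟩ := hW.dom z (hpre.subset hz); exact ⟨a', rfl, Dom_mono (by omega) haD⟩
  -- the three new vertices are in the enlarged domain
  have hz0 : ((x, D.j) : ℤ × ℤ) ∈ Dom c (D.j + 1) := by
    refine ⟨by simp only; omega, ?_⟩; simp only; rw [if_pos (by omega)]; omega
  have hz2 : ((x + 2, D.j) : ℤ × ℤ) ∈ Dom c (D.j + 1) := by
    refine ⟨by simp only; omega, ?_⟩; simp only; rw [if_pos (by omega), abs_le]; omega
  have hzT : ((x + 1, D.j + 1) : ℤ × ℤ) ∈ Dom c (D.j + 1) := by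
    refine ⟨by simp only; omega, ?_⟩; simp only; rw [if_neg (by omega), abs_le]; omega
  -- extend the walk by one edge or by three
  obtain ⟨ys, hys⟩ := List.getLast?_eq_some_iff.1 ha
  rcases key with k | ⟨k1, k2, k3⟩
  · refine ⟨W.dropLast ++ [some (x, D.j)], ?_, ?_, ⟨a₀, by rw [List.head?_append_of_ne_nil _ hne, hhead], ha₀0⟩,
      ⟨(x, D.j), by simp, rfl⟩⟩
    · rw [hys] at hV' ⊢
      exact isWalk_append_singleton hV' (by simp) k
    · intro z hz
      rw [List.mem_append, List.mem_singleton] at hz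
      rcases hz with hz | rfl
      · exact hdomV z hz
      · exact ⟨_, rfl, hz0⟩
  · refine ⟨W.dropLast ++ [some (x + 2, D.j), some (x + 1, D.j + 1), some (x, D.j)], ?_, ?_,
      ⟨a₀, by rw [List.head?_append_of_ne_nil _ hne, hhead], ha₀0⟩, ⟨(x, D.j), by simp, rfl⟩⟩
    · rw [hys] at hV' ⊢
      have w1 := isWalk_append_singleton hV' (by simp) k1
      have w2 := isWalk_append_singleton w1 (by simp) k2
      have w3 := isWalk_append_singleton w2 (by simp) k3
      simpa [List.append_assoc] using w3
    · intro z hz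
      simp only [List.mem_append, List.mem_cons, List.not_mem_nil, or_false] at hz
      rcases hz with hz | rfl | rfl | rfl
      · exact hdomV z hz
      · exact ⟨_, rfl, hz2⟩
      · exact ⟨_, rfl, hzT⟩
      · exact ⟨_, rfl, hz0⟩

/-- **A record above the middle row is kept** (GM14 (6.33), second case): the witness is
transported by the sweep (`sweepW_spec`), its endpoints are unchanged, and its new vertices stay
in the enlarged trapezium. [cite: GrimmettManolescu2014Isoradial, §6.3 (6.33), (6.30)] -/
theorem reaches_sweep_of_gt (hV : D.Valid) {ω : Set (Sym2 SV)} (hc : Clean D.initial ω) {c : ℤ} {N : ℕ}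
    (hwide : c + N + 4 ≤ D.M) (hj : 1 ≤ D.j) {y : ℤ} (hjy : D.j < y) (hyN : y ≤ N) {W : List SV}
    (hW : TopWit (Dom c D.j) ω y W) (r : unitInterval × (Fin (2 * D.M) → unitInterval)) :
    Reaches (Dom c (D.j + 1)) (D.sweep ω r) y := by
  obtain ⟨a₀, ha₀, ha₀0⟩ := hW.head
  obtain ⟨b, hb, hby⟩ := hW.last
  -- heights of the witness are at most `y`
  have hle : ∀ z ∈ W, ∃ a : ℤ × ℤ, z = some a ∧ a ∈ Dom c D.j ∧ a.2 ≤ y := by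
    intro z hz
    obtain ⟨a, rfl, haD⟩ := hW.dom z hz
    refine ⟨a, rfl, haD, ?_⟩
    by_cases hlast : some a ∈ W.dropLast
    · have := hW.below _ hlast; simp only [lht] at this; omega
    · have hWd : W = W.dropLast ++ [some b] := by
        obtain ⟨ys, rfl⟩ := List.getLast?_eq_some_iff.1 hb
        rw [List.dropLast_concat]
      rw [hWd, List.mem_append, List.mem_singleton] at hz
      rcases hz with hz | hz
      · exact absurd hz hlast
      · cases hz; omega
  have hcol : ∀ m y', some (m, y') ∈ W → -(D.M : ℤ) < m ∧ m < (D.M : ℤ) - 1 := by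
    intro m y' hm
    obtain ⟨a, ha, haD, hay⟩ := hle _ hm
    cases ha
    have h1 := abs_le_of_mem_Dom haD
    have h2 := abs_le.1 h1
    simp only at h2 hay
    omega
  have hn : none ∉ W := fun h => by obtain ⟨a, ha, -⟩ := hW.dom _ h; simp at ha
  have spec := sweepW_spec hV (P₀ := some a₀) (P₁ := some b) (by simp)
    (fun i h => by
      simp only [ExchangeData.mid, Option.some.injEq] at h
      have := congrArg Prod.snd h; simp only at this; omega) (by simp)
    (fun i h => by
      simp only [ExchangeData.mid, Option.some.injEq] at h
      have := congrArg Prod.snd h; simp only at this; omega) hc hW.walk ha₀ hb hn hcol r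
  obtain ⟨-, hwalk', hhead', hlast', -, hprov⟩ := spec
  refine ⟨(D.sweepW (ω, W) r).2, ?_, fun z hz => ?_, ⟨a₀, hhead', ha₀0⟩, ⟨b, hlast', hby⟩⟩
  · have : (D.sweepW (ω, W) r).1 = D.sweep ω r := sweepW_fst D (ω, W) r
    rw [← this]; exact hwalk'
  · rcases hprov z hz with hz | ⟨m, y', rfl, hgen⟩
    · obtain ⟨a, rfl, haD, -⟩ := hle z hz
      exact ⟨a, rfl, Dom_mono (by omega) haD⟩
    · refine ⟨(m, y'), rfl, ?_⟩
      rcases hgen with ⟨rfl, hm⟩ | ⟨rfl, hm⟩ | ⟨rfl, hm, -⟩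
      · obtain ⟨a, ha, haD, -⟩ := hle _ hm
        cases ha
        have h2 := haD.2
        have h0 := haD.1
        simp only [lt_self_iff_false, if_false, add_zero] at h2 h0
        have := abs_le.1 h2
        refine ⟨by simp only; omega, ?_⟩; simp only; rw [if_pos (by omega), abs_le]; omega
      · obtain ⟨a, ha, haD, -⟩ := hle _ hm
        cases ha
        have h2 := haD.2
        have h0 := haD.1
        simp only [lt_self_iff_false, if_false, add_zero] at h2 h0
        have := abs_le.1 h2
        refine ⟨by simp only; omega, ?_⟩; simp only; rw [if_pos (by omega), abs_le]; omega
      · obtain ⟨a, ha, haD, -⟩ := hle _ hm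
        cases ha
        have h2 := haD.2
        have h0 := haD.1
        simp only [lt_self_iff_false, if_false, add_zero] at h2 h0
        have := abs_le.1 h2
        refine ⟨by simp only; omega, ?_⟩; simp only; rw [if_neg (by omega), abs_le]; omega

/-! ### The record height after the sweep -/

/-- **GM14 (6.32)–(6.33) for the record height**: after the sweep of level `j` the record height
(cap `N`, trapezium `Dom c (j+1)`) is at least the old one (trapezium `Dom c j`) unless the old
one equals `j`, and at least the old one minus one in any case. Hypotheses: clean configuration,
`1 ≤ j`, `0 ≤ c`, and a strip wide enough (`c + N + 4 ≤ M`).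
[cite: GrimmettManolescu2014Isoradial, §6.3 (6.32)–(6.33)] -/
theorem hRec_sweep_ge (hV : D.Valid) {ω : Set (Sym2 SV)} (hc : Clean D.initial ω) {c : ℤ} {N : ℕ}
    (hc0 : 0 ≤ c) (hwide : c + N + 4 ≤ D.M) (hj : 1 ≤ D.j) (r : unitInterval × (Fin (2 * D.M) → unitInterval)) :
    ((hRec (Dom c D.j) N ω : ℤ) ≠ D.j → hRec (Dom c D.j) N ω ≤ hRec (Dom c (D.j + 1)) N (D.sweep ω r)) ∧
      hRec (Dom c D.j) N ω ≤ hRec (Dom c (D.j + 1)) N (D.sweep ω r) + 1 := by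
  have h00 : ((0 : ℤ), (0 : ℤ)) ∈ Dom c D.j := ⟨le_rfl, by simp only [abs_zero]; split_ifs <;> omega⟩
  have h0 : Reaches (Dom c D.j) ω 0 := reaches_zero h00
  set h := hRec (Dom c D.j) N ω with hh
  have hN : h ≤ N := hRec_le h0
  obtain ⟨W, hW⟩ := exists_topWit hc (by positivity) (reaches_hRec (N := N) h0)
  rw [← hh] at hW
  have key : (h : ℤ) ≠ D.j → h ≤ hRec (Dom c (D.j + 1)) N (D.sweep ω r) := fun hne => by
    rcases lt_or_gt_of_ne hne with hlt | hgt
    · exact le_hRec hN (reaches_sweep_of_lt hc hW hlt r)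
    · exact le_hRec hN (reaches_sweep_of_gt hV hc hwide hj hgt (by exact_mod_cast hN) hW r)
  refine ⟨key, ?_⟩
  by_cases hne : (h : ℤ) = D.j
  · have hW' : TopWit (Dom c D.j) ω D.j W := hne ▸ hW
    have := reaches_sweep_sub_one hc hW' hj r
    have h1 : ((h - 1 : ℕ) : ℤ) = D.j - 1 := by omega
    rw [← h1] at this
    have := le_hRec (N := N) (by omega) this
    omega
  · have := key hne; omega

/-- **GM14 (6.34), deterministic part**: if the record equals the level `j` of the sweep then,
for any top witness `W` of it (last vertex `(x, j)`, previous vertex `(x ∓ 1, j - 1)`), the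
record is kept when the witness comes from the left, and also when it comes from the right
provided `e₃ = (x-2, j)–(x-1, j-1)` is closed and the uniform variable of the move at stage
`x - 1` lies in `goodU x`. [cite: GrimmettManolescu2014Isoradial, §6.3 (6.34), Figs. 6.5–6.6] -/
theorem hRec_sweep_ge_of_topWit (hV : D.Valid) {ω : Set (Sym2 SV)} (hc : Clean D.initial ω) {c : ℤ} {N : ℕ}
    (hwide : c + N + 4 ≤ D.M) (hj : 1 ≤ D.j) (hjN : D.j ≤ N) {W : List SV} (hW : TopWit (Dom c D.j) ω D.j W)
    {a : ℤ × ℤ} {x : ℤ} (ha : W.dropLast.getLast? = some (some a)) (hb : W.getLast? = some (some (x, D.j)))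
    (r : unitInterval × (Fin (2 * D.M) → unitInterval))
    (hgood : a.1 = x + 1 → D.leftFaceEdge x ∉ ω ∧ ∀ t : Fin (2 * D.M), -(D.M : ℤ) + t = x - 1 → r.2 t ∈ D.goodU x) :
    D.j ≤ (hRec (Dom c (D.j + 1)) N (D.sweep ω r) : ℤ) := by
  obtain ⟨a', b', ha', hb', hb'y, hay, hadj⟩ := hW.exists_dropLast_getLast hc (by omega)
  rw [ha] at ha'; rw [hb] at hb'
  cases ha'; cases hb'
  simp only at hadj hay hb'y
  have hreach : Reaches (Dom c (D.j + 1)) (D.sweep ω r) D.j := by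
    rcases hadj with h1 | h1
    · obtain ⟨h3, hu⟩ := hgood h1
      have : a = (x + 1, D.j - 1) := Prod.ext h1 hay
      subst this
      exact reaches_sweep_goodTop hV hc hwide hjN hj hW ha hb h3 r hu
    · have : a = (x - 1, D.j - 1) := Prod.ext h1 hay
      subst this
      exact reaches_sweep_keptTop hV hc hwide hjN hW ha hb r
  have h1 : ((D.j.toNat : ℕ) : ℤ) = D.j := by omega
  have hreach' : Reaches (Dom c (D.j + 1)) (D.sweep ω r) ((D.j.toNat : ℕ) : ℤ) := by rw [h1]; exact hreach
  have := le_hRec (N := N) (by omega) hreach'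
  omega

end ExchangeData

end TrackExchange

end Literature.Probability.Percolation
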